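import Literature.Computability.Complexity.TM2ToStackProgram
import HarnessLib

/-!
# Route UniformStream, crux `UniformMagnification` (stmt-PneNP-16047), line `registered`,
# stub `stub_speedup`: linear speed-up for Mathlib `TM2` machines over `{0,1}`

**Theorem** (`stub_speedup`). For every bundled machine `M : Turing.TM2ComputableAux Bool Bool`
and every `D > 0` there is a machine `M'` with
`M.OutputsWithin l l' m → M'.OutputsWithin l l' ((m + |l| + |l'|) / D + 3)`.

This is the linear speed-up theorem (Hartmanis–Stearns 1965) in Mathlib's `TM2` model, where it
is cheap: a `TM2` statement is a finite tree of `push`/`pop`/`branch` nodes executed in ONE step,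
so boundedly many elementary stack operations can be folded into one machine step.

Proof. Flatten `M` into a binary stack register program `P : AProg Bool (Fin K)` with linear
overhead `e` (`TM2Flat.exists_aprogFin_of_outputsWithin`, `TM2ToStackProgram.lean`): a run of
`m` steps of `M` from `l` to `l'` is a run of `t ≤ e (m + |l| + |l'|) + e` instructions of `P`
from `⟨0, input⟩` to `⟨|P|, output⟩`. Append `goto (|P| + 1)` (so that the program is nonempty
and the run ends at the halted address `|P| + 1` after `t + 1` instructions). Then package the
flat program as a `FinTM2` whose statement at address `pc` is the `d`-fold UNROLLING of the
program from `pc` (`unroll P d pc`: a decision tree executing `d` consecutive instructions,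
branching on popped bits, resetting the internal state at the end), with `d = D (e + 1)`:
`n` machine steps are exactly `d n` program steps (`iterate_suCfg`), so the machine halts with
the output after `⌈(t + 1) / d⌉ ≤ (m + |l| + |l'|) / D + 2` steps (`outputsWithin_su`). The
packaging (`suTM`, `suCfg`, `step_suCfg`) copies the one-instruction-per-step packaging
`AProg.tm` of `SymbolPrograms.lean` / `FlatN.tmN` of `PaulPippengerSzemerediTrotter1983Flat.lean`.

References: J. Hartmanis, R. E. Stearns, *On the computational complexity of algorithms*,
Trans. AMS 117 (1965), Thm. 2 (linear speed-up); S. Arora, B. Barak, *Computational Complexity: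
A Modern Approach*, CUP 2009, §1.3 (Claims 1.5, 1.6: robustness of the model up to constant /
polynomial factors).
-/

namespace Summit.PneNP.PneNP.Cruxes.UniformMagnification.Birth

set_option linter.dupNamespace false -- `Summit.PneNP.PneNP.…`: summit = sub-problem (D-0017)

open Literature.Computability.Complexity Turing Function

section Machine

variable {K : ℕ} (P : AProg Bool (Fin K)) (hP : 0 < P.length) (d : ℕ) (inp out : Fin K)

/-- Jump to address `n`, resetting the internal state: a label if `n < |P|`, else halt
(as `FlatN.addr`). [folklore] -/
def suAddr (n : ℕ) : TM2.Stmt (fun _ : Fin K => Bool) (Fin P.length) (Option Bool) :=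
  if h : n < P.length then .load (fun _ => none) (.goto fun _ => ⟨n, h⟩)
  else .load (fun _ => none) .halt

/-- **The unrolled statement.** `unroll P d pc`: ONE `TM2` statement executing `d` consecutive
instructions of `P` from address `pc` — `push` ↦ `push` and continue with the unrolling from
`pc + 1`; `goto j` ↦ the unrolling from `j`; `pop k j` ↦ `pop` and branch on the popped bit into
the unrollings from `j o`; a halted address in the middle of the block ↦ halt — ending with a
jump to the address reached (`suAddr`). [folklore] -/
def unroll : ℕ → ℕ → TM2.Stmt (fun _ : Fin K => Bool) (Fin P.length) (Option Bool)
  | 0, pc => suAddr P pc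
  | n + 1, pc =>
    match P[pc]? with
    | none => .load (fun _ => none) .halt
    | some (.push k a) => .push k (fun _ => a) (unroll n (pc + 1))
    | some (.goto j) => unroll n j
    | some (.pop k j) => .pop k (fun _ o => o)
        (.branch (fun v => decide (v = some true)) (unroll n (j (some true)))
          (.branch (fun v => decide (v = some false)) (unroll n (j (some false)))
            (unroll n (j none))))

/-- **The sped-up `TM2` machine of a flat binary program**: stacks = registers, input stack
`inp`, output stack `out`, labels = addresses, statement at address `pc` = the `d`-fold
unrolling of the program from `pc`. [folklore] -/
@[reducible] def suTM : FinTM2 where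
  K := Fin K
  k₀ := inp
  k₁ := out
  Γ := fun _ => Bool
  Λ := Fin P.length
  main := ⟨0, hP⟩
  σ := Option Bool
  initialState := none
  m := fun l => unroll P d l.val

/-- The bundled sped-up machine, input and output alphabets being `Bool` itself. [folklore] -/
@[reducible] def suAux : TM2ComputableAux Bool Bool where
  tm := suTM P hP d inp out
  inputAlphabet := Equiv.refl Bool
  outputAlphabet := Equiv.refl Bool

/-- The label of an address (`none` = halted, beyond the program). [folklore] -/
def suLbl (pc : ℕ) : Option (Fin P.length) := if h : pc < P.length then some ⟨pc, h⟩ else none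

/-- The machine configuration of a flat configuration (internal state reset). [folklore] -/
def suCfg (c : ACfg Bool (Fin K)) : (suTM P hP d inp out).Cfg := ⟨suLbl P c.pc, none, c.regs⟩

/-- Semantics of `suAddr`. [folklore] -/
theorem stepAux_suAddr (n : ℕ) (v : Option Bool) (S : ∀ _ : Fin K, List Bool) :
    TM2.stepAux (suAddr P n) v S = ⟨suLbl P n, none, S⟩ := by
  unfold suAddr suLbl
  by_cases h : n < P.length
  · simp [h]
  · simp [h]

/-- **Semantics of the unrolled statement**: executing `unroll P d pc` on the stacks `S` yields
the machine configuration of `P.step^[d] ⟨pc, S⟩`, halting included. [folklore] -/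
theorem stepAux_unroll (n : ℕ) : ∀ (pc : ℕ) (v : Option Bool) (S : ∀ _ : Fin K, List Bool),
    TM2.stepAux (unroll P n pc) v S =
      ⟨suLbl P (P.step^[n] ⟨pc, S⟩).pc, none, (P.step^[n] ⟨pc, S⟩).regs⟩ := by
  induction n with
  | zero => intro pc v S; simp only [unroll, stepAux_suAddr, iterate_zero, id_eq]
  | succ n ih =>
    intro pc v S
    rw [iterate_succ_apply]
    cases hq : P[pc]? with
    | none =>
      have hle : P.length ≤ pc := List.getElem?_eq_none_iff.1 hq
      rw [P.step_of_le (c := ⟨pc, S⟩) hle, P.iterate_step_of_le (c := ⟨pc, S⟩) hle]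
      simp only [unroll, hq, TM2.stepAux, suLbl, dif_neg (Nat.not_lt.2 hle)]
    | some ins =>
      rw [P.step_of_getElem? hq]
      cases ins with
      | push k a =>
        simp only [unroll, hq, TM2.stepAux]
        exact ih _ _ _
      | goto j =>
        simp only [unroll, hq]
        exact ih _ _ _
      | pop k j =>
        rcases hS : S k with _ | ⟨a, w⟩
        · have hu : update S k [] = S := update_eq_self_iff.2 hS.symm
          simp only [unroll, hq, TM2.stepAux, hS, List.head?_nil, List.tail_nil, hu, ih]
          simp
        · cases a
          · simp only [unroll, hq, TM2.stepAux, hS, List.head?_cons, List.tail_cons, ih]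
            simp
          · simp only [unroll, hq, TM2.stepAux, hS, List.head?_cons, List.tail_cons, ih]
            simp

/-- **One machine step is `d` program steps** (inside the program). [folklore] -/
theorem step_suCfg (c : ACfg Bool (Fin K)) (hc : c.pc < P.length) :
    (suTM P hP d inp out).step (suCfg P hP d inp out c) =
      some (suCfg P hP d inp out (P.step^[d] c)) := by
  obtain ⟨pc, R⟩ := c
  change pc < P.length at hc
  have hl : suLbl P pc = some ⟨pc, hc⟩ := by simp [suLbl, hc]
  have hstep : (suTM P hP d inp out).step (suCfg P hP d inp out ⟨pc, R⟩) =
      some (TM2.stepAux (unroll P d pc) none R) := by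
    simp only [FinTM2.step, suCfg, hl]
    rfl
  rw [hstep, stepAux_unroll]
  rfl

/-- Runs of the program are runs of the machine, `d` program steps per machine step, as long as
the block boundaries are inside the program. [folklore] -/
theorem iterate_suCfg (n : ℕ) : ∀ c : ACfg Bool (Fin K),
    (∀ m < n, (P.step^[d * m] c).pc < P.length) →
      (flip bind (suTM P hP d inp out).step)^[n] (some (suCfg P hP d inp out c)) =
        some (suCfg P hP d inp out (P.step^[d * n] c)) := by
  induction n with
  | zero => intro c _; rfl
  | succ n ih =>
    intro c hc
    have h0 : c.pc < P.length := by simpa using hc 0 (Nat.succ_pos n)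
    rw [TM2Comp.iterate_bind_succ, step_suCfg P hP d inp out c h0, ih (P.step^[d] c) ?_,
      ← iterate_add_apply, Nat.mul_succ]
    intro m hm
    rw [← iterate_add_apply, ← Nat.mul_succ]
    exact hc (m + 1) (by omega)

/-- **Running time of the sped-up machine.** If `t` program steps lead from the input
configuration (address `0`, the word `z` in register `inp`, all other registers empty) to a
halted configuration with `w` in register `out` and all other registers empty, then the sped-up
machine outputs `w` on input `z` within `t / d + 1` steps. [folklore] -/
theorem outputsWithin_su (hd : 0 < d) {z w : List Bool} {t pc : ℕ}
    (h : P.step^[t] ⟨0, AStore.single inp z⟩ = ⟨pc, AStore.single out w⟩)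
    (hpc : P.length ≤ pc) : (suAux P hP d inp out).OutputsWithin z w (t / d + 1) := by
  classical
  set c₀ : ACfg Bool (Fin K) := ⟨0, AStore.single inp z⟩ with hc₀
  -- from time `t` on, the run sits at the final configuration
  have hafter : ∀ s, t ≤ s → P.step^[s] c₀ = ⟨pc, AStore.single out w⟩ := fun s hs => by
    rw [← Nat.sub_add_cancel hs, iterate_add_apply, h, P.iterate_step_of_le hpc]
  have hex : ∃ n, P.length ≤ (P.step^[d * n] c₀).pc :=
    ⟨t, by rw [hafter _ (Nat.le_mul_of_pos_left t hd)]; exact hpc⟩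
  set n₀ := Nat.find hex
  have hreach : P.length ≤ (P.step^[d * n₀] c₀).pc := Nat.find_spec hex
  have hbefore : ∀ m < n₀, (P.step^[d * m] c₀).pc < P.length := fun m hm =>
    Nat.lt_of_not_le (Nat.find_min hex hm)
  have hn₀t : n₀ ≤ t / d + 1 :=
    Nat.find_min' hex (by
      rw [hafter _ (Nat.lt_mul_div_succ t hd).le]
      exact hpc)
  -- the halted configuration reached at block boundary `n₀` is the final one
  have hfin : P.step^[d * n₀] c₀ = ⟨pc, AStore.single out w⟩ := by
    rcases le_total t (d * n₀) with hle | hle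
    · exact hafter _ hle
    · have e : P.step^[t] c₀ = P.step^[t - d * n₀] (P.step^[d * n₀] c₀) := by
        rw [← iterate_add_apply, Nat.sub_add_cancel hle]
      rw [← h, e, P.iterate_step_of_le hreach]
  have hrun := iterate_suCfg P hP d inp out n₀ c₀ hbefore
  rw [hfin] at hrun
  -- identify the endpoints with Mathlib's `initList` / `haltList`
  have hinit : suCfg P hP d inp out c₀ = initList (suTM P hP d inp out) z := by
    rw [TM2Comp.initList_eq]
    simp only [suCfg, hc₀, suLbl, dif_pos hP, AStore.single_eq_update]
  have hhalt : suCfg P hP d inp out ⟨pc, AStore.single out w⟩ =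
      haltList (suTM P hP d inp out) w := by
    rw [TM2Comp.haltList_eq]
    simp only [suCfg, suLbl, dif_neg (Nat.not_lt.2 hpc), AStore.single_eq_update]
  have ez : (z.map ((Equiv.refl Bool).symm) : List Bool) = z := by simp
  have ew : (w.map ((Equiv.refl Bool).symm) : List Bool) = w := by simp
  refine ⟨⟨⟨n₀, ?_⟩, hn₀t⟩⟩
  change (flip bind (suTM P hP d inp out).step)^[n₀]
      (some (initList (suTM P hP d inp out) (z.map (Equiv.refl Bool).symm))) =
    some (haltList (suTM P hP d inp out) (w.map (Equiv.refl Bool).symm))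
  rw [ez, ew, ← hinit, ← hhalt]
  exact hrun

end Machine

/-! ### Appending an exit jump to a flat program -/

section Append

variable {K : ℕ}

/-- Inside `P`, a step of `P ++ Q` is a step of `P`. [folklore] -/
theorem step_append_of_lt (P Q : AProg Bool (Fin K)) (c : ACfg Bool (Fin K))
    (hc : c.pc < P.length) : AProg.step (P ++ Q) c = P.step c := by
  unfold AProg.step
  rw [List.getElem?_append_left hc]

/-- A run of `P` that stays inside `P` is a run of `P ++ Q`. [folklore] -/
theorem iterate_append_of_lt (P Q : AProg Bool (Fin K)) (c : ACfg Bool (Fin K)) (n : ℕ)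
    (h : ∀ m < n, (P.step^[m] c).pc < P.length) :
    (AProg.step (P ++ Q))^[n] c = P.step^[n] c := by
  induction n with
  | zero => rfl
  | succ n ih =>
    rw [iterate_succ_apply', iterate_succ_apply', ih fun m hm => h m (by omega),
      step_append_of_lt P Q _ (h n (by omega))]

/-- **Exit jump.** If a run of `P` reaches `⟨|P|, R⟩` after `t` steps, then the same run of
`P ++ [goto (|P| + 1)]` reaches the halted configuration `⟨|P| + 1, R⟩` after `t + 1` steps
(cf. `ACom.exists_computesInTime`). [folklore] -/
theorem iterate_append_goto (P : AProg Bool (Fin K)) (c₀ : ACfg Bool (Fin K)) {t : ℕ}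
    {R : AStore Bool (Fin K)} (h : P.step^[t] c₀ = ⟨P.length, R⟩) :
    (AProg.step (P ++ [AInstr.goto (P.length + 1)]))^[t + 1] c₀ = ⟨P.length + 1, R⟩ := by
  classical
  set Q : AProg Bool (Fin K) := P ++ [AInstr.goto (P.length + 1)] with hQ
  have hex : ∃ n, P.length ≤ (P.step^[n] c₀).pc := ⟨t, by rw [h]⟩
  set n₁ := Nat.find hex
  have hn₁t : n₁ ≤ t := Nat.find_min' hex (by rw [h])
  have hreach : P.length ≤ (P.step^[n₁] c₀).pc := Nat.find_spec hex
  have hbefore : ∀ m < n₁, (P.step^[m] c₀).pc < P.length := fun m hm =>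
    Nat.lt_of_not_le (Nat.find_min hex hm)
  have hPn₁ : P.step^[n₁] c₀ = ⟨P.length, R⟩ := by
    have e : P.step^[t] c₀ = P.step^[t - n₁] (P.step^[n₁] c₀) := by
      rw [← iterate_add_apply, Nat.sub_add_cancel hn₁t]
    rw [← h, e, P.iterate_step_of_le hreach]
  have hQn₁ : Q.step^[n₁] c₀ = ⟨P.length, R⟩ := by
    rw [hQ, iterate_append_of_lt P _ c₀ n₁ hbefore, hPn₁]
  have hgoto : Q[P.length]? = some (AInstr.goto (P.length + 1)) := by simp [hQ]
  have hQs : Q.step^[n₁ + 1] c₀ = ⟨P.length + 1, R⟩ := by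
    rw [iterate_succ_apply', hQn₁, Q.step_of_getElem? hgoto]
  have hlen : Q.length = P.length + 1 := by simp [hQ]
  have e : Q.step^[t + 1] c₀ = Q.step^[t - n₁] (Q.step^[n₁ + 1] c₀) := by
    rw [← iterate_add_apply]
    congr 1
    omega
  rw [e, hQs, Q.iterate_step_of_le (by rw [hlen])]

end Append

/-- **stub_speedup** — linear speed-up in Mathlib's `TM2` model over `{0,1}`: flatten `M` to a
binary stack program with linear overhead `e` (`TM2Flat.exists_aprogFin_of_outputsWithin`),
append an exit jump, and run the flat program on the `TM2` machine whose statement at each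
address unrolls `D (e + 1)` program steps (`suAux`), so that `t + 1 ≤ (e + 1)(m + |l| + |l'| + 1)`
program steps are at most `(m + |l| + |l'|) / D + 2` machine steps.
[cite: AroraBarakCC2009, §1.3 (Claim 1.5, 1.6)] -/
theorem stub_speedup (M : Turing.TM2ComputableAux Bool Bool) (D : ℕ) (hD : 0 < D) :
    ∃ M' : Turing.TM2ComputableAux Bool Bool, ∀ (l l' : List Bool) (m : ℕ),
      M.OutputsWithin l l' m → M'.OutputsWithin l l' ((m + l.length + l'.length) / D + 3) := by
  obtain ⟨K, P, inp, out, e, hP⟩ := TM2Flat.exists_aprogFin_of_outputsWithin M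
  set Q : AProg Bool (Fin K) := P ++ [AInstr.goto (P.length + 1)] with hQ
  have hlen : Q.length = P.length + 1 := by simp [hQ]
  have hQ0 : 0 < Q.length := by omega
  have hd : 0 < D * (e + 1) := Nat.mul_pos hD (Nat.succ_pos e)
  refine ⟨suAux Q hQ0 (D * (e + 1)) inp out, fun l l' m h => ?_⟩
  obtain ⟨t, ht, hrun⟩ := hP l l' m h
  have hrun' : Q.step^[t + 1] ⟨0, AStore.single inp l⟩ = ⟨P.length + 1, AStore.single out l'⟩ :=
    iterate_append_goto P _ hrun
  refine (outputsWithin_su Q hQ0 (D * (e + 1)) inp out hd hrun' (by omega)).mono ?_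
  -- `(t + 1) / (D (e + 1)) + 1 ≤ (m + |l| + |l'|) / D + 3`
  set N := m + l.length + l'.length
  have h1 : t + 1 ≤ (e + 1) * (N + 1) := by
    have : (e + 1) * (N + 1) = e * N + e + N + 1 := by ring
    omega
  have h2 : (t + 1) / (D * (e + 1)) ≤ N / D + 1 :=
    calc (t + 1) / (D * (e + 1)) ≤ (e + 1) * (N + 1) / (D * (e + 1)) := Nat.div_le_div_right h1
      _ = (N + 1) / D := by rw [Nat.mul_comm D, Nat.mul_div_mul_left _ _ (Nat.succ_pos e)]
      _ ≤ (N + D) / D := Nat.div_le_div_right (by omega)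
      _ = N / D + 1 := Nat.add_div_right N hD
  omega

end Summit.PneNP.PneNP.Cruxes.UniformMagnification.Birth
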